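import Mathlib
import Summits.AtomisticToContinuum.HydrodynamicLimit.Theorems.ImplosionDichotomyDenseExcursionSonicSmoothBranchCkEuler

/-!
# The complex `T_ν` lemma: the holomorphic resolvent of the Euler operator `z d/dz + a`, `a > 0`, on a star-shaped domain
# (crux `DenseExcursion`, stmt-AtomisticToContinuum-12586, line `sonic-cavity-renewal` v8, stub `stub_analyticPackingImplosion`)

Helper file (`--supports stmt-AtomisticToContinuum-12586`, line lead a2, wave-4 worker D1, task (1)
`sonicWindow_analytic_bound`, first brick of the CORRECTED window plan — sup norms on a complex TEARDROP around the sonic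
window instead of a `k`-uniform analytic `ℓ¹` jet norm, worker report `work/stubs/D1_gammaClosure.REPORT.md` §3). At the
repulsive sonic point the singular characteristic of the order-`k` problem is `z P′ + a(z) P = h` with `a(0) ≍ kμ/κ > 0`;
written as `z P′ + a(0) P = h − z·ã·P` it is solved by the fixed point of the EXPLICIT holomorphic resolvent of the
constant-coefficient operator, `(T_a h)(z) = ∫₀¹ σ^{a−1} h(σz) dσ`, on any open set star-shaped with respect to `0` on which
`h` is holomorphic. Kernel-checked here:

* `eulerResolvent_holomorphic_bound` (REGISTERED helper): for real `a > 0`, an open set `U ⊂ ℂ` star-convex with respect to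
  `0` and `h` holomorphic on `U`, there is `Y` holomorphic on `U` with `z Y′ + a Y = h` on `U` and the GAIN
  `‖Y z‖ ≤ M/a` whenever `‖h(σz)‖ ≤ M` for `σ ∈ [0, 1]` — the complex twin (order zero) of `eulerResolvent_smooth_bound`;
  derivatives on sub-domains then come from Cauchy estimates, with no `k`-loss.

Proof: differentiation under the integral in the COMPLEX parameter (`hasDerivAt_integral_of_dominated_loc_of_deriv_le` over
`𝕜 = ℂ`, domination by `sup ‖h′‖` on the compact cone over a closed ball), the equation by one integration by parts in `σ`
(`Φ(σ) = σᵃ h(σz)`, `Φ(0) = 0` as `a > 0`), the bound by `∫₀¹ σ^{a−1} dσ = 1/a`.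
Sources: Coddington–Levinson 1955 Ch. 4 §2 (regular singular points), Hille, *ODEs in the complex domain* §5.
NOT here: the `z·ã` contraction, the transport characteristic, the teardrop geometry, or `Γ`.
-/

noncomputable section

open Set Filter MeasureTheory intervalIntegral Metric
open scoped Topology Interval

namespace Summit.AtomisticToContinuum.HydrodynamicLimit.Theorems.PackingAnalyticImplosion

open Summit.AtomisticToContinuum.HydrodynamicLimit.Theorems.SonicCavityRenewal (ofReal_cpow_mul_self)

set_option maxHeartbeats 800000 in -- one declaration: parametric integral, domination, FTC and the bound in one existential
/-- **THE COMPLEX `T_ν` LEMMA — HOLOMORPHIC RESOLVENT OF `z d/dz + a`, `a > 0`, ON A STAR-SHAPED DOMAIN** (registered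
helper `eulerResolvent_holomorphic_bound` of `stub_analyticPackingImplosion`): for `h` holomorphic on an open set `U`
star-convex with respect to `0` there is `Y` holomorphic on `U` solving `z Y′ + a Y = h` with `‖Y z‖ ≤ M/a` whenever
`‖h(σ z)‖ ≤ M` for all `σ ∈ [0, 1]` (`Y = ∫₀¹ σ^{a−1} h(σz) dσ`). [folklore] -/
theorem eulerResolvent_holomorphic_bound : ∀ (a : ℝ) (U : Set ℂ) (h : ℂ → ℂ), 0 < a → IsOpen U → StarConvex ℝ (0 : ℂ) U → DifferentiableOn ℂ h U → ∃ Y : ℂ → ℂ, DifferentiableOn ℂ Y U ∧ (∀ z ∈ U, z * deriv Y z + a * Y z = h z) ∧ ∀ z ∈ U, ∀ M : ℝ, (∀ σ ∈ Set.Icc (0 : ℝ) 1, ‖h ((σ : ℂ) * z)‖ ≤ M) → ‖Y z‖ ≤ M / a := by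
  intro a U h ha hU hst hh
  -- membership of the rays
  have hray : ∀ {z : ℂ}, z ∈ U → ∀ {σ : ℝ}, σ ∈ Icc (0 : ℝ) 1 → (σ : ℂ) * z ∈ U := by
    intro z hz σ hσ
    have h1 := hst hz (sub_nonneg.2 hσ.2) hσ.1 (sub_add_cancel 1 σ)
    simpa [Complex.real_smul] using h1
  -- `h` and `h′` are continuous on `U`
  have hhc : ContinuousOn h U := hh.continuousOn
  have hh' : ∀ z ∈ U, HasDerivAt h (deriv h z) z := fun z hz => (hh.differentiableAt (hU.mem_nhds hz)).hasDerivAt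
  have hdc : ContinuousOn (deriv h) U := (hh.analyticOnNhd hU).deriv.continuousOn
  -- the exponent
  set e : ℂ := ((a : ℂ) - 1) with he
  have he_re : e.re = a - 1 := by simp [he]
  have hcpow_cont : ∀ c : ℂ, ContinuousOn (fun s : ℝ => (s : ℂ) ^ c) (Ioc 0 1) := fun c s hs =>
    (Complex.continuousAt_ofReal_cpow_const s c (Or.inr hs.1.ne')).continuousWithinAt
  have hnorm_cpow : ∀ {s : ℝ}, 0 < s → ‖(s : ℂ) ^ e‖ = s ^ (a - 1) := fun hs => by
    rw [Complex.norm_cpow_eq_rpow_re_of_pos hs, he_re]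
  -- the candidate
  set F : ℂ → ℝ → ℂ := fun z s => (s : ℂ) ^ e * h ((s : ℂ) * z) with hF
  set F' : ℂ → ℝ → ℂ := fun z s => (s : ℂ) ^ e * ((s : ℂ) * deriv h ((s : ℂ) * z)) with hF'
  set Y : ℂ → ℂ := fun z => ∫ s in (0 : ℝ)..1, F z s with hY
  -- measurability of the integrands
  have hmeas : ∀ {z : ℂ}, z ∈ U → ∀ (w : ℝ → ℂ), ContinuousOn w (Ioc 0 1) → ∀ (g : ℂ → ℂ), ContinuousOn g U →
      AEStronglyMeasurable (fun s : ℝ => w s * g ((s : ℂ) * z)) (volume.restrict (Ι (0 : ℝ) 1)) := by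
    intro z hz w hw g hg
    rw [uIoc_of_le zero_le_one]
    refine ContinuousOn.aestronglyMeasurable (hw.mul fun s hs => ?_) measurableSet_Ioc
    have hm : (s : ℂ) * z ∈ U := hray hz ⟨hs.1.le, hs.2⟩
    have h1 : ContinuousAt g ((s : ℂ) * z) := (hg _ hm).continuousAt (hU.mem_nhds hm)
    have h2 : Continuous (fun t : ℝ => (t : ℂ) * z) := by fun_prop
    exact (ContinuousAt.comp (f := fun t : ℝ => (t : ℂ) * z) (x := s) h1 h2.continuousAt).continuousWithinAt
  -- a uniform bound of a continuous `g` on the cone over a closed ball inside `U`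
  have hcone : ∀ {z₀ : ℂ}, z₀ ∈ U → ∃ r : ℝ, 0 < r ∧ closedBall z₀ r ⊆ U ∧ ∀ (g : ℂ → ℂ), ContinuousOn g U →
      ∃ C : ℝ, 0 ≤ C ∧ ∀ z ∈ closedBall z₀ r, ∀ s ∈ Icc (0 : ℝ) 1, ‖g ((s : ℂ) * z)‖ ≤ C := by
    intro z₀ hz₀
    obtain ⟨ε, hε, hball⟩ := Metric.isOpen_iff.1 hU z₀ hz₀
    refine ⟨ε / 2, half_pos hε, (closedBall_subset_ball (half_lt_self hε)).trans hball, fun g hg => ?_⟩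
    have hK : IsCompact ((fun p : ℝ × ℂ => (p.1 : ℂ) * p.2) '' (Icc (0 : ℝ) 1 ×ˢ closedBall z₀ (ε / 2))) :=
      (isCompact_Icc.prod (isCompact_closedBall _ _)).image (by fun_prop)
    have hKU : (fun p : ℝ × ℂ => (p.1 : ℂ) * p.2) '' (Icc (0 : ℝ) 1 ×ˢ closedBall z₀ (ε / 2)) ⊆ U := by
      rintro _ ⟨⟨s, z⟩, ⟨hs, hz⟩, rfl⟩
      exact hray ((closedBall_subset_ball (half_lt_self hε)).trans hball hz) hs
    obtain ⟨C, hC⟩ := hK.exists_bound_of_continuousOn (hg.mono hKU)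
    refine ⟨max C 0, le_max_right _ _, fun z hz s hs => (hC _ ⟨⟨s, z⟩, ⟨hs, hz⟩, rfl⟩).trans (le_max_left _ _)⟩
  -- integrability of `F z` for `z ∈ U`
  have hFint : ∀ {z : ℂ}, z ∈ U → IntervalIntegrable (F z) volume 0 1 := by
    intro z hz
    obtain ⟨r, hr, -, hbd⟩ := hcone hz
    obtain ⟨C, hC0, hC⟩ := hbd h hhc
    have hg : IntervalIntegrable (fun s : ℝ => C * s ^ (a - 1)) volume 0 1 :=
      (intervalIntegral.intervalIntegrable_rpow' (by linarith : (-1 : ℝ) < a - 1)).const_mul C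
    refine hg.mono_fun' (hmeas hz _ (hcpow_cont e) h hhc) ?_
    rw [EventuallyLE, ae_restrict_iff' measurableSet_uIoc]
    refine Eventually.of_forall fun s hs => ?_
    rw [uIoc_of_le zero_le_one] at hs
    simp only [hF]
    rw [norm_mul, hnorm_cpow hs.1, mul_comm]
    exact mul_le_mul_of_nonneg_right (hC z (mem_closedBall_self hr.le) s ⟨hs.1.le, hs.2⟩) (Real.rpow_nonneg hs.1.le _)
  -- DIFFERENTIATION UNDER THE INTEGRAL in the complex parameter
  have hYder : ∀ z₀ ∈ U, IntervalIntegrable (F' z₀) volume 0 1 ∧ HasDerivAt Y (∫ s in (0 : ℝ)..1, F' z₀ s) z₀ := by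
    intro z₀ hz₀
    obtain ⟨r, hr, hrU, hbd⟩ := hcone hz₀
    obtain ⟨C, hC0, hC⟩ := hbd (deriv h) hdc
    have hS : ball z₀ r ∈ 𝓝 z₀ := ball_mem_nhds z₀ hr
    have key := intervalIntegral.hasDerivAt_integral_of_dominated_loc_of_deriv_le (𝕜 := ℂ) (μ := volume)
      (a := (0 : ℝ)) (b := 1) (bound := fun _ => C) (F := F) (F' := F') hS
      (Filter.eventually_of_mem hS fun z hz => hmeas (hrU (ball_subset_closedBall hz)) _ (hcpow_cont e) h hhc)
      (hFint hz₀) ?_ ?_ intervalIntegrable_const ?_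
    · exact key
    · refine (hmeas hz₀ (fun s => (s : ℂ) ^ e * (s : ℂ)) ((hcpow_cont e).mul Complex.continuous_ofReal.continuousOn)
        (deriv h) hdc).congr (Eventually.of_forall fun s => ?_)
      simp only [hF']; ring
    · refine Eventually.of_forall fun s hs z hz => ?_
      rw [uIoc_of_le zero_le_one] at hs
      simp only [hF']
      rw [norm_mul, norm_mul, hnorm_cpow hs.1, Complex.norm_real, Real.norm_eq_abs, abs_of_pos hs.1]
      have h1 : ‖deriv h ((s : ℂ) * z)‖ ≤ C := hC z (ball_subset_closedBall hz) s ⟨hs.1.le, hs.2⟩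
      have h2 : s ^ (a - 1) * s ≤ 1 := by
        rw [← Real.rpow_add_one hs.1.ne', sub_add_cancel]
        exact Real.rpow_le_one hs.1.le hs.2 ha.le
      calc s ^ (a - 1) * (s * ‖deriv h ((s : ℂ) * z)‖) = (s ^ (a - 1) * s) * ‖deriv h ((s : ℂ) * z)‖ := by ring
        _ ≤ 1 * C := mul_le_mul h2 h1 (norm_nonneg _) zero_le_one
        _ = C := one_mul C
    · refine Eventually.of_forall fun s hs z hz => ?_
      have hzU : z ∈ U := hrU (ball_subset_closedBall hz)
      have hsz : (s : ℂ) * z ∈ U := by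
        rw [uIoc_of_le zero_le_one] at hs
        exact hray hzU ⟨hs.1.le, hs.2⟩
      have h1 : HasDerivAt (fun w : ℂ => (s : ℂ) * w) ((s : ℂ)) z := by
        simpa using (hasDerivAt_id z).const_mul (s : ℂ)
      have h2 : HasDerivAt (fun w : ℂ => h ((s : ℂ) * w)) (deriv h ((s : ℂ) * z) * (s : ℂ)) z := (hh' _ hsz).comp z h1
      have h3 := h2.const_mul ((s : ℂ) ^ e)
      simp only [hF, hF']
      exact h3.congr_deriv (by ring)
  have hYdiff : DifferentiableOn ℂ Y U := fun z hz => (hYder z hz).2.differentiableAt.differentiableWithinAt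
  refine ⟨Y, hYdiff, fun z hz => ?_, fun z hz M hM => ?_⟩
  · -- THE EQUATION by integration by parts in `σ`
    rw [(hYder z hz).2.deriv]
    set Φ : ℝ → ℂ := fun s => (s : ℂ) ^ (a : ℂ) * h ((s : ℂ) * z) with hΦ
    set Φ' : ℝ → ℂ := fun s => (a : ℂ) * F z s + z * F' z s with hΦ'
    have ha0 : (a : ℂ) ≠ 0 := Complex.ofReal_ne_zero.2 ha.ne'
    have hΦ0 : Φ 0 = 0 := by
      simp only [hΦ, Complex.ofReal_zero]
      rw [Complex.zero_cpow ha0, zero_mul]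
    have hΦ1 : Φ 1 = h z := by simp [hΦ]
    have hΦder : ∀ s ∈ Ioo (0 : ℝ) 1, HasDerivAt Φ (Φ' s) s := by
      intro s hs
      have hsz : (s : ℂ) * z ∈ U := hray hz ⟨hs.1.le, hs.2.le⟩
      have h1 : HasDerivAt (fun s : ℝ => (s : ℂ) ^ (a : ℂ)) ((a : ℂ) * (s : ℂ) ^ ((a : ℂ) - 1)) s :=
        (Complex.hasStrictDerivAt_cpow_const (c := (a : ℂ)) (Complex.ofReal_mem_slitPlane.2 hs.1)).hasDerivAt.comp_ofReal
      have h2 : HasDerivAt (fun s : ℝ => h ((s : ℂ) * z)) (deriv h ((s : ℂ) * z) * z) s := by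
        have h3 : HasDerivAt (fun s : ℝ => (s : ℂ) * z) z s := by
          simpa using (Complex.ofRealCLM.hasDerivAt (x := s)).mul_const z
        exact (hh' _ hsz).comp s h3
      refine (h1.mul h2).congr_deriv ?_
      simp only [hΦ', hF, hF', he]
      have e4 : (s : ℂ) ^ (a : ℂ) = (s : ℂ) ^ ((a : ℂ) - 1) * (s : ℂ) := by
        rw [ofReal_cpow_mul_self hs.1, sub_add_cancel]
      rw [e4]; ring
    -- continuity of `Φ` on `[0, 1]`
    obtain ⟨r, hr, -, hbd⟩ := hcone hz
    obtain ⟨C, hC0, hC⟩ := hbd h hhc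
    have hΦcont : ContinuousOn Φ (Icc 0 1) := by
      intro s hs
      rcases eq_or_lt_of_le hs.1 with h0 | h0
      · subst h0
        rw [ContinuousWithinAt, hΦ0]
        have hlim : Tendsto (fun s : ℝ => C * s ^ a) (𝓝[Icc 0 1] 0) (𝓝 0) := by
          have h2 := ((Real.continuousAt_rpow_const 0 a (Or.inr ha.le)).tendsto).const_mul C
          rw [Real.zero_rpow ha.ne', mul_zero] at h2
          exact h2.mono_left nhdsWithin_le_nhds
        refine squeeze_zero_norm' (eventually_nhdsWithin_of_forall fun s hs => ?_) hlim
        rcases eq_or_lt_of_le hs.1 with h' | h'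
        · subst h'; rw [hΦ0, norm_zero]; exact mul_nonneg hC0 (Real.rpow_nonneg le_rfl _)
        · simp only [hΦ]
          rw [norm_mul, Complex.norm_cpow_eq_rpow_re_of_pos h', Complex.ofReal_re, mul_comm]
          exact mul_le_mul (hC z (mem_closedBall_self hr.le) s ⟨h'.le, hs.2⟩) le_rfl (Real.rpow_nonneg h'.le _) hC0
      · have hsz : (s : ℂ) * z ∈ U := hray hz ⟨hs.1, hs.2⟩
        have h1 : ContinuousAt h ((s : ℂ) * z) := (hhc _ hsz).continuousAt (hU.mem_nhds hsz)
        have h2 : Continuous (fun t : ℝ => (t : ℂ) * z) := by fun_prop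
        have h3 : ContinuousAt (fun t : ℝ => h ((t : ℂ) * z)) s :=
          ContinuousAt.comp (f := fun t : ℝ => (t : ℂ) * z) (x := s) h1 h2.continuousAt
        exact ((Complex.continuousAt_ofReal_cpow_const s _ (Or.inr h0.ne')).mul h3).continuousWithinAt
    have hint0 : IntervalIntegrable (F z) volume 0 1 := hFint hz
    have hint1 : IntervalIntegrable (F' z) volume 0 1 := (hYder z hz).1
    have hFTC := intervalIntegral.integral_eq_sub_of_hasDerivAt_of_le zero_le_one hΦcont hΦder
      ((hint0.const_mul (a : ℂ)).add (hint1.const_mul z))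
    rw [hΦ1, hΦ0, sub_zero] at hFTC
    have hsplit : (∫ s in (0 : ℝ)..1, Φ' s) = (a : ℂ) * Y z + z * ∫ s in (0 : ℝ)..1, F' z s := by
      simp only [hΦ', hY]
      rw [intervalIntegral.integral_add (hint0.const_mul _) (hint1.const_mul _),
        intervalIntegral.integral_const_mul, intervalIntegral.integral_const_mul]
    rw [hsplit] at hFTC
    linear_combination hFTC
  · -- THE BOUND
    have hM0 : 0 ≤ M := (norm_nonneg _).trans (hM 0 ⟨le_rfl, zero_le_one⟩)
    have hle : ‖Y z‖ ≤ ∫ s in (0 : ℝ)..1, M * s ^ (a - 1) := by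
      refine intervalIntegral.norm_integral_le_of_norm_le zero_le_one (Eventually.of_forall fun s hs => ?_)
        ((intervalIntegral.intervalIntegrable_rpow' (by linarith : (-1 : ℝ) < a - 1)).const_mul M)
      simp only [hF]
      rw [norm_mul, hnorm_cpow hs.1, mul_comm]
      exact mul_le_mul_of_nonneg_right (hM s ⟨hs.1.le, hs.2⟩) (Real.rpow_nonneg hs.1.le _)
    have hval : (∫ s in (0 : ℝ)..1, M * s ^ (a - 1)) = M / a := by
      rw [intervalIntegral.integral_const_mul, integral_rpow (Or.inl (by linarith : (-1 : ℝ) < a - 1)),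
        Real.one_rpow, sub_add_cancel, Real.zero_rpow ha.ne']
      ring
    rw [← hval]
    exact hle

end Summit.AtomisticToContinuum.HydrodynamicLimit.Theorems.PackingAnalyticImplosion

end
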